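import Mathlib
import HarnessLib
import Summits.HubbardSuperconductivity.HubbardSuperconductivity.Theorems.KLProgrammeKLRegimeIsoSectorMultiplierFat

/-!
# Route `KLProgramme` — engine support (stmt-HubbardSuperconductivity-20437, row (b) producer `hexI`, geometry datum `hisoW`): the WEIGHTED
# `(ℤ/2M) × (ℤ/L)²` character-sum `ℓ¹` norm of ANY symbol is at most its `(ℤ/4M) × (ℤ/L)²`-PADDED weighted twin — the weighted companion of
# k3c2-p2's `charSum_l1_le_padded` (cell gate-hubbard-kl, seat p3 g24; brick (F2) of the `hisoW` supplier plan, STATUS 2026-08-29 l.11709)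

WHY.  The weighted multiplier bounds of the engine (p3 g10 W1 `charSumWt_klAnisoPadded_le_uniform`, p4 g7 `IsoTorusBoundAt`) are produced on the PADDED
`4M`-grid of the engine's torus sums, `Σ_{dw ∈ (ℤ/4M)×(ℤ/L)²} (1 + s₀|d̃w₀| + s₁|w̃|₁)·‖Σ_k F(k)·χ^{(4M)}_{k₀}(dw₀)χ_{k⃗}(w)‖`, while the overlap / re-sectorisation
consumers (`overlapKernelWt_sums_le_of_charSumWt_le`, `transferSumsWt_klIso_single_le`, `hisoW` of `isoMomFlowAt_of_wplainLine_isoSingle`) read the `(ℤ/2M)×(ℤ/L)²`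
form `Σ_z (1 + a|z̃₀| + b|z̃|₁)·‖Σ_q χ_q(z)•F(q)‖`.  The dual time lattice embeds as the EVEN points `d = 2z₀` of `ℤ/4M`, where `χ^{(4M)}_{k₀}(2z₀) = χ^{(2M)}_{k₀}(z₀)`
(`TorusBlock.torusChar_lift_eq_reduce`) and the centred representative DOUBLES: `(2z₀)~ = 2·z̃₀` (`valMinAbs_double`), so the time weight `a|z̃₀|` is the padded
weight at rate `a/2`:
* `valMinAbs_double` — for `x : ZMod (2M)`, `((2·x.val : ℕ) : ZMod (4M)).valMinAbs = 2·x.valMinAbs`;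
* **`charSumWt_l1_le_padded`** — `Σ_z (1 + a|z̃₀| + b|z̃₁| + b|z̃₂|)·‖S^{(2M)}[F](z)‖ ≤ Σ_{dw} (1 + (a/2)|d̃w₀| + b|w̃₁| + b|w̃₂|)·‖S^{(4M)}[F](dw)‖` (`a, b ≥ 0`);
* **`charSumWt_le_of_paddedWt`** — the consumable form: a padded bound in W1's normalisation `(1/(|β|L²))·Σ_{dw} (…) ≤ T/ε_x` (`ε_x = β/(2M)`) gives the
  `(ℤ/2M)` weighted character sum `≤ 2M·L²·T` (weighted twin of `charSum_klIso_single_le_of_padded`, any symbol).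
Everything is proved; no definitions; nothing about the model is asserted. [cite: BenfattoGiulianiMastropietro2006, §2.6 (2.81), §2.7 (2.71a)]
-/

noncomputable section

namespace Summit.HubbardSuperconductivity.HubbardSuperconductivity.Theorems.TorusFourierL2

set_option linter.dupNamespace false -- summit = problem name (single-conjunct summit), D-0017

open Finset Literature.MathematicalPhysics.QuantumLattice Literature.Probability.LatticeModels
open Summit.HubbardSuperconductivity.HubbardSuperconductivity.Theorems.KLProgrammeLegKernels
open Summit.HubbardSuperconductivity.HubbardSuperconductivity.Theorems.KLRegimeSplit
open scoped ComplexConjugate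

variable {L M : ℕ} [NeZero L] [NeZero M]

omit [NeZero L] in
/-- **The centred representative doubles under the doubling embedding `ℤ/2M ↪ ℤ/4M`**: `((2·x.val : ℕ) : ZMod (4M)).valMinAbs = 2·x.valMinAbs`. [folklore] -/
theorem valMinAbs_double (x : ZMod (2 * M)) : (((2 * x.val : ℕ) : ZMod (2 * (2 * M))).valMinAbs : ℤ) = 2 * (x.valMinAbs : ℤ) := by
  haveI : NeZero (2 * (2 * M)) := ⟨by have := NeZero.ne M; omega⟩
  have hM := Nat.pos_of_ne_zero (NeZero.ne M)
  have hv : x.val < 2 * M := ZMod.val_lt x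
  have hval : (((2 * x.val : ℕ) : ZMod (2 * (2 * M)))).val = 2 * x.val := by
    rw [ZMod.val_natCast, Nat.mod_eq_of_lt (by omega)]
  rw [ZMod.valMinAbs_def_pos, ZMod.valMinAbs_def_pos, hval]
  have h1 : 2 * (2 * M) / 2 = 2 * M := by omega
  have h2 : 2 * M / 2 = M := by omega
  rw [h1, h2]
  by_cases h : x.val ≤ M
  · rw [if_pos (by omega), if_pos h]; push_cast; ring
  · rw [if_neg (by omega), if_neg h]; push_cast; ring

/-- **The weighted `(ℤ/2M) × (ℤ/L)²` character-sum `ℓ¹` norm is at most the `(ℤ/4M) × (ℤ/L)²`-padded one at HALF the time rate**, for ANY symbol `F` on the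
frequency–momentum carrier and any rates `a, b ≥ 0`. [cite: BenfattoGiulianiMastropietro2006, §2.7 (2.71a)] -/
theorem charSumWt_l1_le_padded (F : FreqMomentum L M → ℂ) {a b : ℝ} (ha : 0 ≤ a) (hb : 0 ≤ b) :
    ∑ z : TorusSite 1 (2 * M) × TorusSite 2 L,
        (1 + a * |(((z.1 0).valMinAbs : ℤ) : ℝ)| + b * |(((z.2 0).valMinAbs : ℤ) : ℝ)| + b * |(((z.2 1).valMinAbs : ℤ) : ℝ)|) *
        ‖∑ q : TorusSite 1 (2 * M) × TorusSite 2 L, (torusChar q.1 z.1 * torusChar q.2 z.2) •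
          F (⟨(q.1 0).val, ZMod.val_lt (q.1 0)⟩, q.2)‖ ≤
      ∑ dw : TorusSite 1 (2 * (2 * M)) × TorusSite 2 L,
        (1 + a / 2 * |(((dw.1 0).valMinAbs : ℤ) : ℝ)| + b * |(((dw.2 0).valMinAbs : ℤ) : ℝ)| + b * |(((dw.2 1).valMinAbs : ℤ) : ℝ)|) *
        ‖∑ k : FreqMomentum L M, F k *
          (torusChar (fun _ : Fin 1 => ((k.1 : ℕ) : ZMod (2 * (2 * M)))) dw.1 * torusChar k.2 dw.2)‖ := by
  haveI : NeZero (2 * (2 * M)) := ⟨by have := NeZero.ne M; omega⟩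
  -- the inner `2M`-sum as a sum over the frequency–momentum carrier
  have hinner : ∀ z : TorusSite 1 (2 * M) × TorusSite 2 L,
      ∑ q : TorusSite 1 (2 * M) × TorusSite 2 L, (torusChar q.1 z.1 * torusChar q.2 z.2) •
          F (⟨(q.1 0).val, ZMod.val_lt (q.1 0)⟩, q.2) =
        ∑ k : FreqMomentum L M, F k * (torusChar (fun _ : Fin 1 => ((k.1 : ℕ) : ZMod (2 * M))) z.1 * torusChar k.2 z.2) := by
    intro z
    rw [← sum_freqMomentum_eq_sum_prodTorus (fun q : TorusSite 1 (2 * M) × TorusSite 2 L =>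
      (torusChar q.1 z.1 * torusChar q.2 z.2) • F (⟨(q.1 0).val, ZMod.val_lt (q.1 0)⟩, q.2))]
    refine sum_congr rfl fun k _ => ?_
    have hk : (⟨(((k.1 : ℕ) : ZMod (2 * M))).val, ZMod.val_lt _⟩ : MatsubaraIdx M) = k.1 := by
      apply Fin.ext
      simp only [ZMod.val_natCast]
      exact Nat.mod_eq_of_lt k.1.isLt
    simp only [smul_eq_mul, hk]
    ring
  -- the doubling embedding of the dual time lattice into `ℤ/4M`
  set ι : TorusSite 1 (2 * M) × TorusSite 2 L → TorusSite 1 (2 * (2 * M)) × TorusSite 2 L :=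
    fun z => (fun j => ((2 * (z.1 j).val : ℕ) : ZMod (2 * (2 * M))), z.2) with hι
  have hιinj : Function.Injective ι := by
    intro z z' h
    have h1 := congr_arg Prod.fst h
    have h2 := congr_arg Prod.snd h
    refine Prod.ext (funext fun j => ?_) h2
    have hj := congr_fun h1 j
    simp only [hι] at hj
    have hv := congr_arg ZMod.val hj
    rw [ZMod.val_natCast, ZMod.val_natCast, Nat.mod_eq_of_lt (by have := ZMod.val_lt (z.1 j); omega),
      Nat.mod_eq_of_lt (by have := ZMod.val_lt (z'.1 j); omega)] at hv
    exact ZMod.val_injective _ (by omega)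
  -- at an embedded point the padded character sum IS the `2M` one, and the padded weight at half time rate IS the `2M` weight
  have hat : ∀ z : TorusSite 1 (2 * M) × TorusSite 2 L,
      ∑ k : FreqMomentum L M, F k *
          (torusChar (fun _ : Fin 1 => ((k.1 : ℕ) : ZMod (2 * (2 * M)))) (ι z).1 * torusChar k.2 (ι z).2) =
        ∑ k : FreqMomentum L M, F k * (torusChar (fun _ : Fin 1 => ((k.1 : ℕ) : ZMod (2 * M))) z.1 * torusChar k.2 z.2) := by
    intro z
    refine sum_congr rfl fun k _ => ?_
    have hlift := TorusBlock.torusChar_lift_eq_reduce (d := 1) (b := 2) (m := 2 * M) (M := 2 * (2 * M)) rfl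
      (fun _ : Fin 1 => ((k.1 : ℕ) : ZMod (2 * (2 * M)))) z.1
    have hred : (fun _ : Fin 1 => ((((k.1 : ℕ) : ZMod (2 * (2 * M)))).val : ZMod (2 * M))) =
        fun _ : Fin 1 => ((k.1 : ℕ) : ZMod (2 * M)) := by
      funext
      rw [ZMod.val_natCast, Nat.mod_eq_of_lt (by have := k.1.isLt; omega)]
    simp only [hι]
    rw [hlift, hred]
  have hwt : ∀ z : TorusSite 1 (2 * M) × TorusSite 2 L,
      1 + a / 2 * |((((ι z).1 0).valMinAbs : ℤ) : ℝ)| + b * |((((ι z).2 0).valMinAbs : ℤ) : ℝ)| + b * |((((ι z).2 1).valMinAbs : ℤ) : ℝ)| =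
        1 + a * |(((z.1 0).valMinAbs : ℤ) : ℝ)| + b * |(((z.2 0).valMinAbs : ℤ) : ℝ)| + b * |(((z.2 1).valMinAbs : ℤ) : ℝ)| := by
    intro z
    simp only [hι]
    rw [valMinAbs_double (z.1 0)]
    push_cast
    rw [abs_mul, abs_two]
    ring
  have hnn : ∀ dw : TorusSite 1 (2 * (2 * M)) × TorusSite 2 L,
      0 ≤ (1 + a / 2 * |(((dw.1 0).valMinAbs : ℤ) : ℝ)| + b * |(((dw.2 0).valMinAbs : ℤ) : ℝ)| + b * |(((dw.2 1).valMinAbs : ℤ) : ℝ)|) *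
        ‖∑ k : FreqMomentum L M, F k *
          (torusChar (fun _ : Fin 1 => ((k.1 : ℕ) : ZMod (2 * (2 * M)))) dw.1 * torusChar k.2 dw.2)‖ := fun dw => by positivity
  calc ∑ z : TorusSite 1 (2 * M) × TorusSite 2 L,
        (1 + a * |(((z.1 0).valMinAbs : ℤ) : ℝ)| + b * |(((z.2 0).valMinAbs : ℤ) : ℝ)| + b * |(((z.2 1).valMinAbs : ℤ) : ℝ)|) *
        ‖∑ q : TorusSite 1 (2 * M) × TorusSite 2 L, (torusChar q.1 z.1 * torusChar q.2 z.2) •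
          F (⟨(q.1 0).val, ZMod.val_lt (q.1 0)⟩, q.2)‖
      = ∑ z : TorusSite 1 (2 * M) × TorusSite 2 L,
          (1 + a / 2 * |((((ι z).1 0).valMinAbs : ℤ) : ℝ)| + b * |((((ι z).2 0).valMinAbs : ℤ) : ℝ)| + b * |((((ι z).2 1).valMinAbs : ℤ) : ℝ)|) *
          ‖∑ k : FreqMomentum L M, F k *
            (torusChar (fun _ : Fin 1 => ((k.1 : ℕ) : ZMod (2 * (2 * M)))) (ι z).1 * torusChar k.2 (ι z).2)‖ := by
        refine sum_congr rfl fun z _ => ?_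
        rw [hinner z, hat z, hwt z]
    _ = ∑ dw ∈ (univ : Finset (TorusSite 1 (2 * M) × TorusSite 2 L)).image ι,
          (1 + a / 2 * |(((dw.1 0).valMinAbs : ℤ) : ℝ)| + b * |(((dw.2 0).valMinAbs : ℤ) : ℝ)| + b * |(((dw.2 1).valMinAbs : ℤ) : ℝ)|) *
          ‖∑ k : FreqMomentum L M, F k *
            (torusChar (fun _ : Fin 1 => ((k.1 : ℕ) : ZMod (2 * (2 * M)))) dw.1 * torusChar k.2 dw.2)‖ := by
        rw [Finset.sum_image fun z _ z' _ h => hιinj h]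
    _ ≤ _ := Finset.sum_le_sum_of_subset_of_nonneg (Finset.subset_univ _) fun dw _ _ => hnn dw

/-- **Consumable form**: if, in the engine's padded normalisation, `(1/(|β|L²))·Σ_{dw} (1 + (a/2)|d̃w₀| + b|w̃₁| + b|w̃₂|)·‖Σ_k F(k)·Χ(k; dw)‖ ≤ T / ε_x`
(`ε_x = imagTimeWeight β M = β/(2M)`, `β > 0`), then `Σ_z (1 + a|z̃₀| + b|z̃₁| + b|z̃₂|)·‖S^{(2M)}[F](z)‖ ≤ 2M·L²·T`.
[cite: BenfattoGiulianiMastropietro2006, §2.6 (2.81)] -/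
theorem charSumWt_le_of_paddedWt {β : ℝ} (hβ : 0 < β) (F : FreqMomentum L M → ℂ) {a b : ℝ} (ha : 0 ≤ a) (hb : 0 ≤ b) {T : ℝ}
    (hT : 1 / (|β| * (L : ℝ) ^ 2) *
        ∑ dw : TorusSite 1 (2 * (2 * M)) × TorusSite 2 L,
          (1 + a / 2 * |(((dw.1 0).valMinAbs : ℤ) : ℝ)| + b * |(((dw.2 0).valMinAbs : ℤ) : ℝ)| + b * |(((dw.2 1).valMinAbs : ℤ) : ℝ)|) *
          ‖∑ k : FreqMomentum L M, F k *
            (torusChar (fun _ : Fin 1 => ((k.1 : ℕ) : ZMod (2 * (2 * M)))) dw.1 * torusChar k.2 dw.2)‖ ≤ T / imagTimeWeight β M) :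
    ∑ z : TorusSite 1 (2 * M) × TorusSite 2 L,
        (1 + a * |(((z.1 0).valMinAbs : ℤ) : ℝ)| + b * |(((z.2 0).valMinAbs : ℤ) : ℝ)| + b * |(((z.2 1).valMinAbs : ℤ) : ℝ)|) *
        ‖∑ q : TorusSite 1 (2 * M) × TorusSite 2 L, (torusChar q.1 z.1 * torusChar q.2 z.2) •
          F (⟨(q.1 0).val, ZMod.val_lt (q.1 0)⟩, q.2)‖ ≤ 2 * M * (L : ℝ) ^ 2 * T := by
  have hL : (0 : ℝ) < L := Nat.cast_pos.2 (Nat.pos_of_ne_zero (NeZero.ne L))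
  have hM : (0 : ℝ) < M := Nat.cast_pos.2 (Nat.pos_of_ne_zero (NeZero.ne M))
  have hc : 0 < 1 / (|β| * (L : ℝ) ^ 2) := by rw [abs_of_pos hβ]; positivity
  refine (charSumWt_l1_le_padded F ha hb).trans ?_
  set S := ∑ dw : TorusSite 1 (2 * (2 * M)) × TorusSite 2 L,
          (1 + a / 2 * |(((dw.1 0).valMinAbs : ℤ) : ℝ)| + b * |(((dw.2 0).valMinAbs : ℤ) : ℝ)| + b * |(((dw.2 1).valMinAbs : ℤ) : ℝ)|) *
          ‖∑ k : FreqMomentum L M, F k *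
            (torusChar (fun _ : Fin 1 => ((k.1 : ℕ) : ZMod (2 * (2 * M)))) dw.1 * torusChar k.2 dw.2)‖ with hS
  have h1 : S ≤ T / imagTimeWeight β M / (1 / (|β| * (L : ℝ) ^ 2)) := (le_div_iff₀ hc).2 (by rw [mul_comm]; exact hT)
  refine h1.trans (le_of_eq ?_)
  rw [imagTimeWeight, abs_of_pos hβ]
  field_simp

end Summit.HubbardSuperconductivity.HubbardSuperconductivity.Theorems.TorusFourierL2

end
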